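import Summits.RiemannHypothesis.RiemannHypothesis.Theorems.JensenLogBandArcLambda3
import Summits.RiemannHypothesis.RiemannHypothesis.Theorems.JensenLogBandArcHalfAnnulus
import HarnessLib

/-!
# First and second derivatives of the denominator `D(u)` in closed form (BAND line, S4b input)

RH ladder column JENSEN, rung J-P(P3) «log band», BAND crux `XiDerivBandRealAllRates` of route
«JensenLogBand», line «band-one-window» (u-arc reshape), lead rh-jensen-prover g7 — step (b) of the
S4b recipe in HOME/rh-jensen-prover/g7-work/LINE-PLAN.md §8.4. RH-FREE (Γ-factor only). WHAT THIS
IS NOT: nothing here bears on zeros of `ζ` or the truth of RH.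

`D(u) = λ′(½+u) + 1/u − (n+1)/(u+c)` has `D′(u) = λ″(½+u) − 1/u² + (n+1)/(u+c)²`
(`saddleDen1`, `hasDerivAt_saddleDen_eq`) and `D″(u) = λ‴(½+u) + 2/u³ − 2(n+1)/(u+c)³`
(`saddleDen2`, `hasDerivAt_saddleDen1`), with
`‖D″(u)‖ ≤ 1/(2(0.58T)²) + 30/(0.58T − 1/5) + 2/(0.58T)³ + 2(n+1)/(1.58T)³` on the part of the
right half-annulus where `Re(½+u) ≥ 1/5` (`norm_saddleDen2_le`) — `r³‖D″‖ = O(τ h² + τ³ n)`, so the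
third log-derivative of the `ζ`-free density along the window is `O(n)` (§8.4 (c)).
-/

noncomputable section

-- single-problem summit: `Summit.RiemannHypothesis.RiemannHypothesis.…` is the tree convention
set_option linter.dupNamespace false

open Complex Real Set

namespace Summit.RiemannHypothesis.RiemannHypothesis.Theorems.JensenPolynomials.LogBandArc

open Literature.NumberTheory.LFunctions

variable {n : ℕ} {x T : ℝ} {c u : ℂ}

/-- `D′(u) = λ″(½+u) − 1/u² + (n+1)/(u+c)²` in closed form. [folklore] -/
def saddleDen1 (n : ℕ) (c u : ℂ) : ℂ := lamPrime2 (1 / 2 + u) - 1 / u ^ 2 + ((n : ℂ) + 1) / (u + c) ^ 2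

/-- `D″(u) = λ‴(½+u) + 2/u³ − 2(n+1)/(u+c)³` in closed form (`λ‴ = deriv lamPrime2`). [folklore] -/
def saddleDen2 (n : ℕ) (c u : ℂ) : ℂ :=
  deriv lamPrime2 (1 / 2 + u) + 2 / u ^ 3 - 2 * ((n : ℂ) + 1) / (u + c) ^ 3

/-- **`D′` in closed form:** for `Im(½+u) > 0`, `u ≠ 0`, `u + c ≠ 0`,
`HasDerivAt D (saddleDen1 n c u) u`. [folklore] -/
theorem hasDerivAt_saddleDen_eq (n : ℕ) (c : ℂ) (him : 0 < (1 / 2 + u).im) (hu0 : u ≠ 0)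
    (huc : u + c ≠ 0) : HasDerivAt (fun w : ℂ => saddleDen n c w) (saddleDen1 n c u) u := by
  have hlam : HasDerivAt lamPrime (lamPrime2 (1 / 2 + u)) (1 / 2 + u) := hasDerivAt_lamPrime him
  have hlam' : HasDerivAt (fun w : ℂ => lamPrime (1 / 2 + w)) (lamPrime2 (1 / 2 + u)) u := by
    have hid : HasDerivAt (fun w : ℂ => (1 / 2 : ℂ) + w) 1 u := (hasDerivAt_id u).const_add _
    have hcomp : HasDerivAt (fun w : ℂ => lamPrime (1 / 2 + w)) (lamPrime2 (1 / 2 + u) * 1) u :=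
      HasDerivAt.comp u hlam hid
    rw [mul_one] at hcomp
    exact hcomp
  have hinv : HasDerivAt (fun w : ℂ => 1 / w) (-(1 / u ^ 2)) u := by
    have := hasDerivAt_inv hu0
    simpa only [one_div] using this
  have hfrac : HasDerivAt (fun w : ℂ => ((n : ℂ) + 1) / (w + c)) (-(((n : ℂ) + 1) / (u + c) ^ 2)) u := by
    have h1 : HasDerivAt (fun w : ℂ => (w + c)⁻¹) (-1 / (u + c) ^ 2) u := by
      have := ((hasDerivAt_id u).add_const c).fun_inv huc
      simpa using this
    have h2 := h1.const_mul ((n : ℂ) + 1)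
    refine h2.congr_deriv ?_ |>.congr_of_eventuallyEq ?_
    · field_simp
    · exact Filter.Eventually.of_forall fun w => by simp [div_eq_mul_inv]
  have := (hlam'.add hinv).sub hfrac
  refine this.congr_deriv ?_ |>.congr_of_eventuallyEq ?_
  · rw [saddleDen1]; ring
  · exact Filter.Eventually.of_forall fun w => by simp [saddleDen]

/-- **`D″` in closed form:** for `Im(½+u) > 0`, `u ≠ 0`, `u + c ≠ 0`,
`HasDerivAt D′ (saddleDen2 n c u) u`. [folklore] -/
theorem hasDerivAt_saddleDen1 (n : ℕ) (c : ℂ) (him : 0 < (1 / 2 + u).im) (hu0 : u ≠ 0)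
    (huc : u + c ≠ 0) : HasDerivAt (fun w : ℂ => saddleDen1 n c w) (saddleDen2 n c u) u := by
  have hU : IsOpen {z : ℂ | 0 < z.im} := isOpen_lt continuous_const Complex.continuous_im
  have hL : HasDerivAt lamPrime2 (deriv lamPrime2 (1 / 2 + u)) (1 / 2 + u) :=
    ((differentiableOn_lamPrime2 (1 / 2 + u) him).differentiableAt (hU.mem_nhds him)).hasDerivAt
  have hL' : HasDerivAt (fun w : ℂ => lamPrime2 (1 / 2 + w)) (deriv lamPrime2 (1 / 2 + u)) u := by
    have hid : HasDerivAt (fun w : ℂ => (1 / 2 : ℂ) + w) 1 u := (hasDerivAt_id u).const_add _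
    have hcomp : HasDerivAt (fun w : ℂ => lamPrime2 (1 / 2 + w)) (deriv lamPrime2 (1 / 2 + u) * 1) u :=
      HasDerivAt.comp u hL hid
    rw [mul_one] at hcomp
    exact hcomp
  have hinv2 : HasDerivAt (fun w : ℂ => 1 / w ^ 2) (-(2 / u ^ 3)) u := by
    have h1 : HasDerivAt (fun w : ℂ => (w ^ 2)⁻¹) (-(((2 : ℕ) : ℂ) * u ^ (2 - 1) * 1) / (u ^ 2) ^ 2) u :=
      ((hasDerivAt_id u).pow 2).fun_inv (pow_ne_zero 2 hu0)
    refine (h1.congr_of_eventuallyEq (Filter.Eventually.of_forall fun w => by simp [one_div])).congr_deriv ?_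
    push_cast
    field_simp
  have hfrac2 : HasDerivAt (fun w : ℂ => ((n : ℂ) + 1) / (w + c) ^ 2)
      (-(2 * ((n : ℂ) + 1) / (u + c) ^ 3)) u := by
    have h1 : HasDerivAt (fun w : ℂ => ((w + c) ^ 2)⁻¹)
        (-(((2 : ℕ) : ℂ) * (u + c) ^ (2 - 1) * 1) / ((u + c) ^ 2) ^ 2) u :=
      (((hasDerivAt_id u).add_const c).pow 2).fun_inv (pow_ne_zero 2 huc)
    have h2 := h1.const_mul ((n : ℂ) + 1)
    refine (h2.congr_of_eventuallyEq (Filter.Eventually.of_forall fun w => by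
      simp [div_eq_mul_inv])).congr_deriv ?_
    push_cast
    field_simp
  have := (hL'.sub hinv2).add hfrac2
  refine this.congr_deriv ?_ |>.congr_of_eventuallyEq ?_
  · rw [saddleDen2]; ring
  · exact Filter.Eventually.of_forall fun w => by simp [saddleDen1]

/-- **Bound for `D″` on the window part of the right half-annulus** (`Re(½+u) ≥ 1/5`):
`‖D″(u)‖ ≤ 1/(2(0.58T)²) + 30/(0.58T − 1/5) + 2/(0.58T)³ + 2(n+1)/(1.58T)³`. [folklore] -/
theorem norm_saddleDen2_le (hx : |x| ≤ 1 / 2) (hT : 100 ≤ T) (hh : 1 / 2 ≤ bandRadius n T)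
    (hhT : bandRadius n T ≤ 7 / 20 * T) (hure : 0 ≤ (u - ((x : ℂ) + (T : ℂ) * I)).re)
    (hur : ‖u - ((x : ℂ) + (T : ℂ) * I)‖ ≤ 6 / 5 * bandRadius n T)
    (hre5 : 1 / 5 ≤ (1 / 2 + u).re) :
    ‖saddleDen2 n ((x : ℂ) + (T : ℂ) * I) u‖ ≤
      1 / (2 * (29 / 50 * T) ^ 2) + 30 / (29 / 50 * T - 1 / 5) + 2 / (29 / 50 * T) ^ 3 +
        2 * ((n : ℝ) + 1) / (79 / 50 * T) ^ 3 := by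
  set c : ℂ := (x : ℂ) + (T : ℂ) * I with hc
  set s : ℂ := 1 / 2 + u with hs
  obtain ⟨him_lo, -, -, -, hns_lo, -, hnu_lo, -, -, hnuc⟩ := halfAnnulus_geometry hx hT hh hhT hure hur
  rw [← hc] at hnuc
  rw [← hs] at him_lo hns_lo
  have hT0 : 0 < T := by linarith
  have hlam3 := norm_deriv_lamPrime2_add_le (s := s) (by linarith) hre5
  -- ‖λ‴(s)‖ ≤ 1/(2‖s‖²) + 30/(Im s − 1/5)
  have h1 : ‖deriv lamPrime2 s‖ ≤ 1 / (2 * (29 / 50 * T) ^ 2) + 30 / (29 / 50 * T - 1 / 5) := by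
    have hsplit : ‖deriv lamPrime2 s‖ ≤ ‖deriv lamPrime2 s + 1 / (2 * s ^ 2)‖ + ‖1 / (2 * s ^ 2)‖ := by
      have := norm_sub_le (deriv lamPrime2 s + 1 / (2 * s ^ 2)) (1 / (2 * s ^ 2))
      rwa [add_sub_cancel_right] at this
    have ha : ‖1 / (2 * s ^ 2)‖ ≤ 1 / (2 * (29 / 50 * T) ^ 2) := by
      rw [norm_div, norm_one, norm_mul, Complex.norm_two, norm_pow]
      exact one_div_le_one_div_of_le (by positivity)
        (mul_le_mul_of_nonneg_left (pow_le_pow_left₀ (by positivity) hns_lo 2) (by norm_num))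
    have hb : 30 / (s.im - 1 / 5) ≤ 30 / (29 / 50 * T - 1 / 5) :=
      div_le_div_of_nonneg_left (by norm_num) (by linarith) (by linarith)
    linarith
  have hu0 : 0 < ‖u‖ := by linarith
  have h2 : ‖(2 : ℂ) / u ^ 3‖ ≤ 2 / (29 / 50 * T) ^ 3 := by
    rw [norm_div, Complex.norm_two, norm_pow]
    exact div_le_div_of_nonneg_left (by norm_num) (by positivity) (pow_le_pow_left₀ (by positivity) hnu_lo 3)
  have h3 : ‖2 * ((n : ℂ) + 1) / (u + c) ^ 3‖ ≤ 2 * ((n : ℝ) + 1) / (79 / 50 * T) ^ 3 := by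
    rw [norm_div, norm_pow, norm_mul, Complex.norm_two]
    have hn1 : ‖(n : ℂ) + 1‖ = (n : ℝ) + 1 := by
      rw [show ((n : ℂ) + 1) = ((n + 1 : ℕ) : ℂ) by push_cast; ring, Complex.norm_natCast]; push_cast; ring
    rw [hn1]
    exact div_le_div_of_nonneg_left (by positivity) (by positivity) (pow_le_pow_left₀ (by positivity) hnuc 3)
  calc ‖saddleDen2 n c u‖
      = ‖deriv lamPrime2 s + 2 / u ^ 3 - 2 * ((n : ℂ) + 1) / (u + c) ^ 3‖ := by rw [saddleDen2]
    _ ≤ ‖deriv lamPrime2 s‖ + ‖(2 : ℂ) / u ^ 3‖ + ‖2 * ((n : ℂ) + 1) / (u + c) ^ 3‖ := norm_sub_le_of_le (norm_add_le _ _) le_rfl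
    _ ≤ _ := by linarith

end Summit.RiemannHypothesis.RiemannHypothesis.Theorems.JensenPolynomials.LogBandArc

end
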